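import Mathlib.RingTheory.Ideal.Operations
import Mathlib.RingTheory.Ideal.Maps
import Mathlib.RingTheory.LocalRing.MaximalIdeal.Basic
import HarnessLib

/-!
# [OURS · L1 W4.5(b) · EL♮] COMPANION POINTS AND LIFTED HYPERSURFACES THROUGH A NOSE — ring form of COMPANIONS ADDENDUM C §C.4/§C.8
# (crux `EquisingularLiftNat` = stmt-ResolutionOfSingularities-20038; PARENT ≥ 4 band / kill test #50 K5-BMY)

HONEST FRAMING. OURS (cell res-hironaka, crux chain w45b, slot W4.5(b)); NOT a statement of any manuscript; replaces the role of NOTHING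
in the manuscript; AI-written, AI review is weaker than expert review. Helper `--supports stmt-ResolutionOfSingularities-20038 --as helper`.
Memo: `L/res-L1-w45b-lead-1/COMPANIONS-ADDENDUM-C.md` (res-L1-w45b-lead-1 gen 9) §C.4 (the door as one embedded-smoothing problem) and §C.8
(the dichotomy «does the hypersurface lift through the nose?»).

THE SITUATION. `A = 𝒪_{C,z}` is the local ring of the REGULAR nose `C ⊂ ℙ⁵_O` at a companion point `z`; `t` is a local equation of the
avatar `S ⊂ C` (a prime element: `S` is integral), `b` a local equation of the companion divisor `R′`, and `ϖ = t·b·u` (`u` a unit) since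
`C_s = div ϖ = S + R′`. At a companion point `b` is NOT a unit and `b ∉ (t)` (`R′ ⊅ S`). The hypersurface `H = V(G)` has `G ∈ I_S²`, so
the image of `G` in `A` lies in `(t²)`: `G = t²·w`, where the residue of `w` along `S` is the isotropy function of the shadow direction.

THE THREE FACTS (all [folklore] commutative algebra; their content is the geometric reading):
* `mul_mul_mem_maximalIdeal_sq` — `ϖ = t·b·u ∈ 𝔪²`: **the nose is never `O`-smooth at a companion point** (so `T_z C ⊂ T_z ℙ⁵_k` and the
  shadow direction lives in `N_{S/ℙ⁵_k}` — Addendum C (ℓ2), LEMMA C.2 (i)).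
* `mem_span_of_add_mul_eq_zero` — if a LIFT `G̃ = G + ϖ·G₁` of the hypersurface vanishes on the nose (`G + ϖ·G₁ = 0` in `A`, the tail
  `ϖ²G₂ + …` absorbed into `G₁`), then `G₁ ∈ (t)`: **a lifted hypersurface through a companion nose has its `ϖ`-coefficient in `I_S`, i.e.
  `G̃ ∈ (I_{S ⊂ ℙ⁵_O})²` — it is singular along the whole of `S`** (Addendum C §C.8, case (L+)).
* `dvd_of_sq_mul_add_eq_zero` — in that case, writing `G = t²·w` and `G₁ = t·g₁`: `w = −b·u·g₁`, so **`b ∣ w` exactly: the companion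
  equation divides the residual function of `H` on the shadow** (refines E1's `b_red ∣ w` of COMPANIONS I.1 (c)).

References: [folklore]; memo COMPANIONS-ADDENDUM-C.md §C.4/§C.8; companion file `…NatCompanionIsotropy` (p559693).
-/

set_option linter.dupNamespace false -- mandated namespace `Summit.<Summit>.<Problem>` of this single-conjunct summit

universe u

namespace Summit.ResolutionOfSingularities.ResolutionOfSingularities.Cruxes.EquisingularLiftNat.Sections

namespace CompanionLift

variable {A : Type u} [CommRing A]

/-- **The nose is not `O`-smooth at a companion point**: with `t, b ∈ 𝔪` (avatar and companion both pass through `z`) the uniformiser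
`ϖ = t·b·u` lies in `𝔪²`. OURS. [folklore] -/
theorem mul_mul_mem_maximalIdeal_sq [IsLocalRing A] {t b : A} (u : A) (ht : t ∈ IsLocalRing.maximalIdeal A)
    (hb : b ∈ IsLocalRing.maximalIdeal A) : t * b * u ∈ (IsLocalRing.maximalIdeal A) ^ 2 := by
  rw [pow_two]
  exact Ideal.mul_mem_right u _ (Ideal.mul_mem_mul ht hb)

/-- The same for any ideal `I` containing `t` and `b` (e.g. `I = 𝔪_z`, or `I = I_{D′}`): `t·b·u ∈ I²`. OURS. [folklore] -/
theorem mul_mul_mem_sq {I : Ideal A} {t b : A} (u : A) (ht : t ∈ I) (hb : b ∈ I) : t * b * u ∈ I ^ 2 := by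
  rw [pow_two]
  exact Ideal.mul_mem_right u _ (Ideal.mul_mem_mul ht hb)

/-- **A lifted hypersurface through a companion nose is singular along all of `S`** (ring form). In a domain `A` (= `𝒪_{C,z}`) let
`(t)` be prime (the avatar), `b ∉ (t)` (the companion is not `S`), `G ∈ (t²)` (`G ∈ I_S²`) and suppose the lift `G + (t·b·u)·G₁`
vanishes in `A`. Then `G₁ ∈ (t)`. Proof: `G = t²g`, so `t·(t g + b u G₁) = 0`, hence `b·(u G₁) ∈ (t)` and primality. OURS. [folklore] -/
theorem mem_span_of_add_mul_eq_zero [IsDomain A] {t b u G G₁ : A} (hprime : (Ideal.span {t}).IsPrime) (ht : t ≠ 0)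
    (hb : b ∉ Ideal.span {t}) (hu : IsUnit u) (hG : G ∈ Ideal.span {t ^ 2}) (hlift : G + t * b * u * G₁ = 0) :
    G₁ ∈ Ideal.span {t} := by
  obtain ⟨g, rfl⟩ := Ideal.mem_span_singleton'.mp hG
  have h1 : t * (g * t + b * (u * G₁)) = 0 := by
    have : t * (g * t + b * (u * G₁)) = g * t ^ 2 + t * b * u * G₁ := by ring
    rw [this, hlift]
  have h2 : g * t + b * (u * G₁) = 0 := (mul_eq_zero.mp h1).resolve_left ht
  have h3 : b * (u * G₁) ∈ Ideal.span {t} := by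
    have : b * (u * G₁) = -(g * t) := eq_neg_of_add_eq_zero_right h2
    rw [this]
    exact neg_mem_iff.mpr (Ideal.mul_mem_left _ g (Ideal.mem_span_singleton_self t))
  have h4 : u * G₁ ∈ Ideal.span {t} := (hprime.mem_or_mem h3).resolve_left hb
  obtain ⟨v, hv⟩ := hu.exists_left_inv
  have : G₁ = v * (u * G₁) := by rw [← mul_assoc, hv, one_mul]
  rw [this]
  exact Ideal.mul_mem_left _ v h4

/-- **Exact divisibility of the residual function.** With `G = t²·w` (the hypersurface restricted to the shadow germ), `G₁ = t·g₁`
(output of `mem_span_of_add_mul_eq_zero`) and `G + (t·b·u)·G₁ = 0` in a domain with `t ≠ 0`: `w = −(b·u·g₁)`, in particular `b ∣ w`.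
OURS. [folklore] -/
theorem eq_neg_of_sq_mul_add_eq_zero [IsDomain A] {t b u w g₁ : A} (ht : t ≠ 0)
    (hlift : t ^ 2 * w + t * b * u * (t * g₁) = 0) : w = -(b * u * g₁) := by
  have h1 : t ^ 2 * (w + b * u * g₁) = 0 := by
    have : t ^ 2 * (w + b * u * g₁) = t ^ 2 * w + t * b * u * (t * g₁) := by ring
    rw [this, hlift]
  have h2 : w + b * u * g₁ = 0 := (mul_eq_zero.mp h1).resolve_left (pow_ne_zero 2 ht)
  exact eq_neg_of_add_eq_zero_left h2

/-- `b ∣ w` under the same hypotheses: the companion equation divides the residual function of `H` on the shadow. OURS. [folklore] -/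
theorem dvd_of_sq_mul_add_eq_zero [IsDomain A] {t b u w g₁ : A} (ht : t ≠ 0)
    (hlift : t ^ 2 * w + t * b * u * (t * g₁) = 0) : b ∣ w := by
  rw [eq_neg_of_sq_mul_add_eq_zero ht hlift]
  exact (dvd_neg).mpr (Dvd.intro (u * g₁) (by ring))

/-- **Packaged (L+) statement.** In a domain with `(t)` prime, `t ≠ 0`, `b ∉ (t)`, `u` a unit: if `G = t²·w` and the lift
`G + (t·b·u)·G₁` vanishes, then `G₁ = t·g₁` for some `g₁` with `w = −(b·u·g₁)`; so both the `ϖ`-coefficient of the lift lies in `I_S`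
and the companion equation divides the residual function. OURS. [folklore] -/
theorem exists_of_lift_vanishing [IsDomain A] {t b u w G₁ : A} (hprime : (Ideal.span {t}).IsPrime) (ht : t ≠ 0)
    (hb : b ∉ Ideal.span {t}) (hu : IsUnit u) (hlift : t ^ 2 * w + t * b * u * G₁ = 0) :
    ∃ g₁ : A, G₁ = t * g₁ ∧ w = -(b * u * g₁) := by
  have hG : t ^ 2 * w ∈ Ideal.span {t ^ 2} := Ideal.mul_mem_right w _ (Ideal.mem_span_singleton_self _)
  have hG₁ : G₁ ∈ Ideal.span {t} := mem_span_of_add_mul_eq_zero hprime ht hb hu hG hlift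
  obtain ⟨g₁, hg₁⟩ := Ideal.mem_span_singleton'.mp hG₁
  refine ⟨g₁, by rw [← hg₁, mul_comm], ?_⟩
  have hlift' : t ^ 2 * w + t * b * u * (t * g₁) = 0 := by rw [mul_comm t g₁, hg₁]; exact hlift
  exact eq_neg_of_sq_mul_add_eq_zero ht hlift'

end CompanionLift

end Summit.ResolutionOfSingularities.ResolutionOfSingularities.Cruxes.EquisingularLiftNat.Sections
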